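import Mathlib
import Literature.Analysis.ODE.InverseSquareLadder
import Literature.Analysis.ODE.InverseSquareLadderPreimageVanishing
import Literature.Analysis.ODE.InverseSquareLadderCoercivity
import Literature.Analysis.PDE.DAlembertSmooth
import Literature.Analysis.PDE.InverseSquareLadderWave
import Literature.Analysis.PDE.InverseSquareChannelIdentityReversed
import Literature.Analysis.Calculus.TaylorJet
import HarnessLib

/-!
# The exact inverse-square exterior channel estimate for compactly supported data

Analysis/PDE support file (everything proved). Fix `n : ℕ`, a smooth `ι` with `ι = 1/x` on
`[½,∞)` and a smooth primitive `I`. There is `c = c(n, ι) > 0` such that for all Cauchy data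
`h ∈ C²`, `g ∈ C¹` vanishing on `[B,∞)` (`B ≥ 1`) the explicit exact solution `φ` of
`φ_tt − φ_xx + n(n+1) ι² φ = 0` (for `x > ½`) with data `(h, g)` — the Darboux ladder of the free
wave
with pre-image data — has exterior channel energies `L± = lim_{t→±∞} ∫_{x>1+|t|} e[φ](t,x) dx`
dominating the energy of the data on `(1, X)` MODULO an explicit kernel datum
(ladders of Taylor polynomials at `x = 1`):

  `c ∫_1^X ((h−P)')² + n(n+1)ι²(h−P)² + (g−Q)² ≤ L⁺ + L⁻`   for every `X ≥ 1`

(`inverseSquare_channel_estimate_compact`). Ingredients: pre-images based at `B`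
(`InverseSquareLadderPreimageVanishing`), `C^{n+2}` d'Alembert (`DAlembertSmooth`), ladder waves
(`InverseSquareLadderWave`), the channel limits (`InverseSquareChannelIdentity(Reversed)`), the
identity `2(F^{(n+1)})² + 2(G^{(n+1)})² = (h̃^{(n+1)})² + (g̃^{(n)})²`, and coercivity modulo
Taylor polynomials (`InverseSquareLadderCoercivity`, `TaylorJet`). This is the 1D form of the
exterior
energy estimate for radial waves in odd dimension `d = 2n+3` outside a ball, modulo its
finite-dimensional kernel (Kenig–Lawrie–Liu–Schlag 2015, Thm. 5), for compactly supported data;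
route PhotonSphereChannels, `FixedModeChannels`, far side (stmt-FinalStateConjecture-10048).
-/

noncomputable section

namespace Literature.Analysis.PDE

open Set Filter Topology MeasureTheory Finset Literature.Analysis.ODE Literature.Analysis.Calculus

variable {ι : ℝ → ℝ}

/-- A `C¹` function vanishing on `[B, ∞)` has vanishing derivative on `[B, ∞)`. [folklore] -/
theorem deriv_eq_zero_of_eqOn_Ici {f : ℝ → ℝ} (hf : Differentiable ℝ f) {B : ℝ}
    (h0 : ∀ x, B ≤ x → f x = 0) (x : ℝ) (hx : B ≤ x) : deriv f x = 0 := by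
  have hw : HasDerivWithinAt f (deriv f x) (Ici x) x := (hf x).hasDerivAt.hasDerivWithinAt
  have hw0 : HasDerivWithinAt f 0 (Ici x) x := by
    refine (hasDerivWithinAt_const x (Ici x) (0 : ℝ)).congr (fun y hy => ?_) ?_
    · exact h0 y (hx.trans hy)
    · exact h0 x hx
  exact ((uniqueDiffOn_Ici x) x self_mem_Ici).eq_deriv _ hw hw0

/-- Taylor sums of length `n` kill the jet below `n` (the `n = 0` case is vacuous). [folklore] -/
theorem iteratedDeriv_sub_taylorSum_lt {f : ℝ → ℝ} {n : ℕ} (hf : ContDiff ℝ n f) (R : ℝ)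
    {j : ℕ} (hj : j < n) :
    iteratedDeriv j (fun x => f x - ∑ m ∈ range n,
      iteratedDeriv m f R / m.factorial * (x - R) ^ m) R = 0 := by
  obtain ⟨k, rfl⟩ : ∃ k, n = k + 1 := ⟨n - 1, by omega⟩
  exact iteratedDeriv_sub_taylorSum (hf.of_le (by exact_mod_cast Nat.le_succ k)) R
    (Nat.lt_succ_iff.1 hj)

/-- **Exact inverse-square exterior channel estimate, compactly supported data.** See the module
docstring. [cite: KenigEtAl2015, Theorem 5 (exterior energy, odd d)] -/
theorem inverseSquare_channel_estimate_compact (hι : ContDiff ℝ (⊤ : ℕ∞) ι)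
    (hιeq : ∀ x : ℝ, 1 / 2 ≤ x → ι x = x⁻¹) {I : ℝ → ℝ} (hI : ContDiff ℝ (⊤ : ℕ∞) I)
    (hI' : ∀ x, HasDerivAt I (ι x) x) (n : ℕ) :
    ∃ c : ℝ, 0 < c ∧ ∀ (h g : ℝ → ℝ), ContDiff ℝ 2 h → ContDiff ℝ 1 g → ∀ B : ℝ, 1 ≤ B →
      (∀ x, B ≤ x → h x = 0) → (∀ x, B ≤ x → g x = 0) →
      ∃ (φ : ℝ → ℝ → ℝ) (ch cg : ℕ → ℝ) (Lp Lm : ℝ),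
        ContDiff ℝ 2 (Function.uncurry φ) ∧
        (∀ t, ∀ x ∈ Ioi (1 / 2 : ℝ), iteratedDeriv 2 (fun τ => φ τ x) t
            = iteratedDeriv 2 (φ t) x - n * (n + 1) * ι x ^ 2 * φ t x) ∧
        (∀ x, φ 0 x = h x) ∧ (∀ x, deriv (fun τ => φ τ x) 0 = g x) ∧
        Tendsto (fun t => ∫ x in Ioi (1 + t),
          (deriv (fun τ => φ τ x) t ^ 2 + deriv (φ t) x ^ 2
            + (n : ℝ) * (n + 1) * ι x ^ 2 * φ t x ^ 2)) atTop (𝓝 Lp) ∧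
        Tendsto (fun t => ∫ x in Ioi (1 - t),
          (deriv (fun τ => φ τ x) t ^ 2 + deriv (φ t) x ^ 2
            + (n : ℝ) * (n + 1) * ι x ^ 2 * φ t x ^ 2)) atBot (𝓝 Lm) ∧
        ∀ X : ℝ, 1 ≤ X →
          c * ∫ x in (1 : ℝ)..X,
            (deriv (fun y => h y - ladder ι n (fun z => ∑ m ∈ range (n + 1),
                ch m / m.factorial * (z - 1) ^ m) y) x ^ 2
              + (n : ℝ) * (n + 1) * ι x ^ 2 * (h x - ladder ι n (fun z => ∑ m ∈ range (n + 1),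
                ch m / m.factorial * (z - 1) ^ m) x) ^ 2
              + (g x - ladder ι n (fun z => ∑ m ∈ range n,
                cg m / m.factorial * (z - 1) ^ m) x) ^ 2)
            ≤ Lp + Lm := by
  have hSo : IsOpen (Ioi (1 / 2 : ℝ)) := isOpen_Ioi
  have hric : ∀ x ∈ Ioi (1 / 2 : ℝ), deriv ι x = -(ι x) ^ 2 := by
    intro x hx
    have hx' : (1 / 2 : ℝ) < x := hx
    have hx0 : x ≠ 0 := by intro h; rw [h] at hx'; norm_num at hx'
    have hev : ι =ᶠ[𝓝 x] fun y => y⁻¹ :=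
      Filter.mem_of_superset (Ioi_mem_nhds hx') fun y hy => hιeq y (le_of_lt hy)
    rw [hev.deriv_eq, deriv_inv, hιeq x hx'.le]; field_simp
  obtain ⟨Cp, hCp0, hCp⟩ := exists_ladder_energy_integral_le hι hιeq n
  obtain ⟨Cv, hCv0, hCv⟩ := exists_ladder_sq_integral_le hι hιeq n
  refine ⟨1 / (Cp + Cv + 1), by positivity, ?_⟩
  intro h g hh hg B hB hhB hgB
  -- pre-images based at `B`, vanishing on `[B, ∞)`
  obtain ⟨ht, htC, htlad, ht0⟩ := exists_ladder_preimage_vanishing hI hI' B n hh hhB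
  obtain ⟨gt, gtC, gtlad, gt0⟩ := exists_ladder_preimage_vanishing hI hI' B n hg hgB
  have htC' : ContDiff ℝ (n + 2) ht := by
    have : ((2 + n : ℕ) : ℕ∞) = (n + 2 : ℕ) := by rw [add_comm]
    exact_mod_cast (this ▸ htC)
  have gtC' : ContDiff ℝ (n + 1) gt := by
    have : ((1 + n : ℕ) : ℕ∞) = (n + 1 : ℕ) := by rw [add_comm]
    exact_mod_cast (this ▸ gtC)
  -- the free wave and the ladder wave
  obtain ⟨Φ, F, G, hΦC, hFC, hGC, hrep, hFG, hGF, hfree, hd0, hv0, -, -⟩ :=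
    exists_dAlembert_solution_contDiff htC' gtC'
  have hΦC' : ContDiff ℝ ((n + 2 : ℕ) : ℕ∞) (Function.uncurry Φ) := by exact_mod_cast hΦC
  obtain ⟨hφC2, hφsol⟩ := ladder_wave hι hSo hric (n := n) hΦC' hfree
  set φ : ℝ → ℝ → ℝ := fun t => ladder ι n (Φ t) with hφ
  -- data
  have hΦ0 : Φ 0 = ht := funext hd0
  have hdat0 : ∀ x, φ 0 x = h x := by
    intro x; show ladder ι n (Φ 0) x = h x; rw [hΦ0, htlad]
  have hdat1 : ∀ x, deriv (fun τ => φ τ x) 0 = g x := by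
    intro x
    show deriv (fun τ => ladder ι n (Φ τ) x) 0 = g x
    rw [deriv_ladder_param hι hΦC' 0 x]
    have : (fun y => deriv (fun τ => Φ τ y) 0) = gt := funext hv0
    rw [this, gtlad]
  -- profiles are constant beyond `B` with `F + G = 0` there
  have hFd : Differentiable ℝ F := hFC.differentiable (by simp)
  have hGd : Differentiable ℝ G := hGC.differentiable (by simp)
  have htd : Differentiable ℝ ht := htC'.differentiable (by simp)
  have ht'0 : ∀ x, B ≤ x → deriv ht x = 0 := deriv_eq_zero_of_eqOn_Ici htd ht0
  have hF'0 : ∀ x, B ≤ x → deriv F x = 0 := by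
    intro x hx
    have h1 : deriv F x + deriv G x = deriv ht x := by
      have e : ht = fun y => F y + G y := funext fun y => (hFG y).symm
      rw [e, deriv_fun_add (hFd x) (hGd x)]
    have h2 := hGF x
    rw [ht'0 x hx] at h1; rw [gt0 x hx] at h2
    linarith
  have hG'0 : ∀ x, B ≤ x → deriv G x = 0 := by
    intro x hx; have h2 := hGF x; rw [gt0 x hx, hF'0 x hx] at h2; linarith
  have hconst : ∀ {f : ℝ → ℝ}, Differentiable ℝ f → Continuous (deriv f) →
      (∀ x, B ≤ x → deriv f x = 0) → ∀ x, B ≤ x → f x = f B := by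
    intro f hf hfc hf' x hx
    have hint : (∫ y in B..x, deriv f y) = 0 :=
      intervalIntegral.integral_zero_ae (Filter.Eventually.of_forall fun y hy => by
        rw [uIoc_of_le hx] at hy; exact hf' y hy.1.le)
    have hftc := intervalIntegral.integral_eq_sub_of_hasDerivAt
      (fun y _ => (hf y).hasDerivAt) (hfc.intervalIntegrable B x)
    linarith
  have h12 : (1 : WithTop ℕ∞) ≤ (n : WithTop ℕ∞) + 2 := by
    have : ((1 : ℕ) : WithTop ℕ∞) ≤ ((n + 2 : ℕ) : WithTop ℕ∞) := by
      exact_mod_cast (by omega : 1 ≤ n + 2)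
    exact_mod_cast this
  have hFB : ∀ x, B ≤ x → F x = F B := hconst hFd (hFC.continuous_deriv h12) hF'0
  have hGB : ∀ x, B ≤ x → G x = -F B := by
    intro x hx
    have h1 : G x = G B := hconst hGd (hGC.continuous_deriv h12) hG'0 x hx
    have h2 : F B + G B = 0 := by rw [hFG B, ht0 B le_rfl]
    linarith
  -- channel limits
  have hlimp := inverseSquare_channel_limit_atTop hι hιeq n (by exact_mod_cast hFC)
    (by exact_mod_cast hGC) le_rfl hB hFB hGB hrep
  have hlimm := inverseSquare_channel_limit_atBot hι hιeq n (by exact_mod_cast hFC)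
    (by exact_mod_cast hGC) le_rfl hB hFB hGB hrep
  set Lp : ℝ := 2 * ∫ y in (1 : ℝ)..B, iteratedDeriv (n + 1) F y ^ 2 with hLp
  set Lm : ℝ := 2 * ∫ y in (1 : ℝ)..B, iteratedDeriv (n + 1) G y ^ 2 with hLm
  -- Taylor coefficients at `x = 1`
  set ch : ℕ → ℝ := fun m => iteratedDeriv m ht 1 with hch
  set cg : ℕ → ℝ := fun m => iteratedDeriv m gt 1 with hcg
  refine ⟨φ, ch, cg, Lp, Lm, hφC2, hφsol, hdat0, hdat1, hlimp, hlimm, fun X hX => ?_⟩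
  -- Taylor polynomials and the reduced pre-images
  set Th : ℝ → ℝ := fun z => ∑ m ∈ range (n + 1), ch m / m.factorial * (z - 1) ^ m with hTh
  set Tg : ℝ → ℝ := fun z => ∑ m ∈ range n, cg m / m.factorial * (z - 1) ^ m with hTg
  have hThC : ∀ N : ℕ∞, ContDiff ℝ N Th := fun N => contDiff_taylorSum _ _ _
  have hTgC : ∀ N : ℕ∞, ContDiff ℝ N Tg := fun N =>
    ContDiff.sum fun m _ => contDiff_const.mul ((contDiff_id.sub contDiff_const).pow m)
  set kh : ℝ → ℝ := fun x => ht x - Th x with hkh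
  set kg : ℝ → ℝ := fun x => gt x - Tg x with hkg
  have htCn1 : ContDiff ℝ ((n + 1 : ℕ) : ℕ∞) ht :=
    htC'.of_le (by push_cast; gcongr; norm_num)
  have htCn : ContDiff ℝ n ht := htC'.of_le (by exact_mod_cast (by omega : n ≤ n + 2))
  have gtCn : ContDiff ℝ n gt := gtC'.of_le (by exact_mod_cast Nat.le_succ _)
  have hkhC : ContDiff ℝ ((n + 1 : ℕ) : ℕ∞) kh := htCn1.sub (hThC _)
  have hkgC : ContDiff ℝ n kg := gtCn.sub (hTgC _)
  -- ladders of the reduced pre-images are the reduced data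
  have hladh : ladder ι n kh = fun x => h x - ladder ι n Th x := by
    rw [hkh, ladder_sub hι htCn (hThC n), htlad]
  have hladg : ladder ι n kg = fun x => g x - ladder ι n Tg x := by
    rw [hkg, ladder_sub hι gtCn (hTgC n), gtlad]
  -- vanishing jets at `x = 1`
  have hjh : ∀ j ≤ n, iteratedDeriv j kh 1 = 0 := fun j hj => iteratedDeriv_sub_taylorSum htCn 1 hj
  have hjg : ∀ j < n, iteratedDeriv j kg 1 = 0 := fun j hj =>
    iteratedDeriv_sub_taylorSum_lt gtCn 1 hj
  -- coercivity
  have cpos := hCp kh hkhC 1 X le_rfl hX hjh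
  have cvel := hCv kg hkgC 1 X le_rfl hX hjg
  rw [hladh] at cpos
  rw [hladg] at cvel
  -- top derivatives of the reduced pre-images
  have hpoly0 : ∀ (c : ℕ → ℝ) (N : ℕ) (x : ℝ),
      iteratedDeriv N (fun z => ∑ m ∈ range N, c m / m.factorial * (z - 1) ^ m) x = 0 := by
    intro c N x
    rw [iteratedDeriv_fun_sum fun m _ =>
      (contDiff_const.mul ((contDiff_id.sub contDiff_const).pow m)).contDiffAt]
    refine Finset.sum_eq_zero fun m hm => ?_
    have hmN : m < N := mem_range.1 hm
    rw [iteratedDeriv_const_mul _ ((contDiff_id.sub contDiff_const).pow m |>.contDiffAt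
      |>.of_le le_top)]
    have e := congrFun (iteratedDeriv_comp_sub_const (n := N) (f := fun y : ℝ => y ^ m) (s := 1)) x
    rw [e, iteratedDeriv_pow, Nat.descFactorial_eq_zero_iff_lt.2 hmN]
    simp
  have htoph : ∀ x, iteratedDeriv (n + 1) kh x = iteratedDeriv (n + 1) ht x := by
    intro x
    rw [hkh, iteratedDeriv_fun_sub htCn1.contDiffAt (hThC _).contDiffAt, hpoly0 ch (n + 1) x,
      sub_zero]
  have htopg : ∀ x, iteratedDeriv n kg x = iteratedDeriv n gt x := by
    intro x
    rw [hkg, iteratedDeriv_fun_sub gtCn.contDiffAt (hTgC _).contDiffAt, hpoly0 cg n x, sub_zero]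
  simp only [htoph] at cpos
  simp only [htopg] at cvel
  -- the top derivatives vanish beyond `B`, so `∫_1^X ≤ ∫_1^B`
  have hvanish : ∀ {f : ℝ → ℝ} (N : ℕ), (∀ x, B ≤ x → f x = 0) → ∀ x, B < x →
      iteratedDeriv N f x = 0 := by
    intro f N hf0 x hx
    have hev : f =ᶠ[𝓝 x] fun _ => 0 :=
      Filter.mem_of_superset (Ioi_mem_nhds hx) fun y hy => hf0 y (le_of_lt hy)
    rw [hev.iteratedDeriv_eq N, iteratedDeriv_const]; simp
  have htrunc : ∀ {f : ℝ → ℝ}, Continuous f → (∀ x, B < x → f x = 0) →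
      ∫ x in (1 : ℝ)..X, f x ^ 2 ≤ ∫ x in (1 : ℝ)..B, f x ^ 2 := by
    intro f hf hf0
    have hfi : ∀ a b : ℝ, IntervalIntegrable (fun x => f x ^ 2) volume a b := fun a b =>
      (hf.pow 2).intervalIntegrable a b
    rcases le_or_gt X B with hXB | hBX
    · exact intervalIntegral.integral_mono_interval le_rfl hX hXB
        (Filter.Eventually.of_forall fun x => sq_nonneg (f x)) (hfi 1 B)
    · rw [← intervalIntegral.integral_add_adjacent_intervals (hfi 1 B) (hfi B X)]
      have : (∫ x in B..X, f x ^ 2) = 0 :=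
        intervalIntegral.integral_zero_ae (Filter.Eventually.of_forall fun x hx => by
          rw [uIoc_of_le hBX.le] at hx; simp [hf0 x hx.1])
      rw [this, add_zero]
  have hIh : (∫ x in (1 : ℝ)..X, iteratedDeriv (n + 1) ht x ^ 2)
      ≤ ∫ x in (1 : ℝ)..B, iteratedDeriv (n + 1) ht x ^ 2 :=
    htrunc (htC'.continuous_iteratedDeriv _ (by exact_mod_cast Nat.le_succ _)) (hvanish _ ht0)
  have hIg : (∫ x in (1 : ℝ)..X, iteratedDeriv n gt x ^ 2)
      ≤ ∫ x in (1 : ℝ)..B, iteratedDeriv n gt x ^ 2 :=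
    htrunc (gtC'.continuous_iteratedDeriv _ (by exact_mod_cast Nat.le_succ _)) (hvanish _ gt0)
  -- the channel sum equals the top-derivative energy of the pre-images
  have hsumF : ∀ y, iteratedDeriv (n + 1) F y + iteratedDeriv (n + 1) G y
      = iteratedDeriv (n + 1) ht y := by
    intro y
    have e : ht = fun z => F z + G z := funext fun z => (hFG z).symm
    rw [e, iteratedDeriv_fun_add (hFC.contDiffAt.of_le (by exact_mod_cast Nat.le_succ _))
      (hGC.contDiffAt.of_le (by exact_mod_cast Nat.le_succ _))]
  have hdifF : ∀ y,
      iteratedDeriv (n + 1) G y - iteratedDeriv (n + 1) F y = iteratedDeriv n gt y := by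
    intro y
    have e : gt = fun z => deriv G z - deriv F z := funext fun z => (hGF z).symm
    have hdG : ContDiff ℝ n (deriv G) := hGC.continuous_deriv h12 |> fun _ =>
      (contDiff_succ_iff_deriv.1 (hGC.of_le (by exact_mod_cast Nat.le_succ _) :
        ContDiff ℝ ((n : WithTop ℕ∞) + 1) G)).2.2
    have hdF : ContDiff ℝ n (deriv F) :=
      (contDiff_succ_iff_deriv.1 (hFC.of_le (by exact_mod_cast Nat.le_succ _) :
        ContDiff ℝ ((n : WithTop ℕ∞) + 1) F)).2.2
    rw [e, iteratedDeriv_fun_sub hdG.contDiffAt hdF.contDiffAt, iteratedDeriv_succ',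
      iteratedDeriv_succ']
  have hchan : Lp + Lm = (∫ y in (1 : ℝ)..B, iteratedDeriv (n + 1) ht y ^ 2)
      + ∫ y in (1 : ℝ)..B, iteratedDeriv n gt y ^ 2 := by
    have cF : Continuous (iteratedDeriv (n + 1) F) := hFC.continuous_iteratedDeriv _ (by
      exact_mod_cast Nat.le_succ _)
    have cG : Continuous (iteratedDeriv (n + 1) G) := hGC.continuous_iteratedDeriv _ (by
      exact_mod_cast Nat.le_succ _)
    have i1 : IntervalIntegrable (fun y => 2 * iteratedDeriv (n + 1) F y ^ 2) volume 1 B :=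
      ((cF.pow 2).const_mul 2).intervalIntegrable _ _
    have i2 : IntervalIntegrable (fun y => 2 * iteratedDeriv (n + 1) G y ^ 2) volume 1 B :=
      ((cG.pow 2).const_mul 2).intervalIntegrable _ _
    have i3 : IntervalIntegrable (fun y => iteratedDeriv (n + 1) ht y ^ 2) volume 1 B :=
      ((htC'.continuous_iteratedDeriv _ (by exact_mod_cast Nat.le_succ _)).pow 2)
        |>.intervalIntegrable _ _
    have i4 : IntervalIntegrable (fun y => iteratedDeriv n gt y ^ 2) volume 1 B :=
      ((gtC'.continuous_iteratedDeriv _ (by exact_mod_cast Nat.le_succ _)).pow 2)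
        |>.intervalIntegrable _ _
    rw [hLp, hLm, ← intervalIntegral.integral_const_mul, ← intervalIntegral.integral_const_mul,
      ← intervalIntegral.integral_add i1 i2, ← intervalIntegral.integral_add i3 i4]
    refine intervalIntegral.integral_congr fun y _ => ?_
    have a := hsumF y; have b := hdifF y
    show 2 * iteratedDeriv (n + 1) F y ^ 2 + 2 * iteratedDeriv (n + 1) G y ^ 2
      = iteratedDeriv (n + 1) ht y ^ 2 + iteratedDeriv n gt y ^ 2
    rw [← a, ← b]; ring
  -- integrability of the three pieces of the data energy
  have hhc : Continuous h := hh.continuous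
  have hgc : Continuous g := hg.continuous
  have hLT : ∀ N : ℕ, ContDiff ℝ N (ladder ι n Th) := fun N => contDiff_ladder hι (m := N) (hThC _)
  have hLTg : ∀ N : ℕ, ContDiff ℝ N (ladder ι n Tg) := fun N => contDiff_ladder hι (m := N) (hTgC _)
  have hdC2 : ContDiff ℝ 2 (fun y => h y - ladder ι n Th y) := hh.sub (by exact_mod_cast hLT 2)
  have cA : Continuous fun x => deriv (fun y => h y - ladder ι n Th y) x :=
    hdC2.continuous_deriv (by norm_num)
  have cAB : Continuous fun x => deriv (fun y => h y - ladder ι n Th y) x ^ 2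
      + (n : ℝ) * (n + 1) * ι x ^ 2 * (h x - ladder ι n Th x) ^ 2 :=
    (cA.pow 2).add ((continuous_const.mul (hι.continuous.pow 2)).mul (hdC2.continuous.pow 2))
  have cC : Continuous fun x => (g x - ladder ι n Tg x) ^ 2 :=
    (hgc.sub (hLTg 0).continuous).pow 2
  rw [intervalIntegral.integral_add (cAB.intervalIntegrable _ _) (cC.intervalIntegrable _ _)]
  -- conclude
  have hIh0 : 0 ≤ ∫ x in (1 : ℝ)..B, iteratedDeriv (n + 1) ht x ^ 2 :=
    intervalIntegral.integral_nonneg hB fun x _ => sq_nonneg _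
  have hIg0 : 0 ≤ ∫ x in (1 : ℝ)..B, iteratedDeriv n gt x ^ 2 :=
    intervalIntegral.integral_nonneg hB fun x _ => sq_nonneg _
  have e1 := cpos.trans (mul_le_mul_of_nonneg_left hIh hCp0)
  have e2 := cvel.trans (mul_le_mul_of_nonneg_left hIg hCv0)
  rw [hchan]
  set Ih := ∫ x in (1 : ℝ)..B, iteratedDeriv (n + 1) ht x ^ 2
  set Ig := ∫ x in (1 : ℝ)..B, iteratedDeriv n gt x ^ 2
  have hden : 0 < Cp + Cv + 1 := by positivity
  rw [div_mul_eq_mul_div, one_mul, div_le_iff₀ hden]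
  nlinarith [e1, e2, hIh0, hIg0, hCp0, hCv0, mul_nonneg hCv0 hIh0, mul_nonneg hCp0 hIg0]

end Literature.Analysis.PDE
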